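import Literature.Probability.Percolation.SelfRefinementMeasure
import Literature.Probability.Percolation.KohlerSchindlerTassionRSW
import Summits.CriticalPhenomena.CardyFormulaZ2.Theorems.CardySelfRefinementCriticalPathRSWStubCone3SmallB
import Summits.CriticalPhenomena.CardyFormulaZ2.Theorems.CardySelfRefinementCriticalPathRSWStubCone3Patterns
import Summits.CriticalPhenomena.CardyFormulaZ2.Theorems.CardySelfRefinementCriticalPathRSWStubCone3LargeB

/-!
# Stub `stub_cone3` of line `finite-size-envelope` (crux `CriticalPathRSW`), part 17:
the one-sided cone inequality of a single tuple, and of every tuple of the box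

Support file for item `stmt-CriticalPhenomena-10267` (stub `stub_cone3`).  For a tuple `(b, d)`
of `M_3` lying in the box `[-3n, 3n] × [-9n, 9n]` and not inside one of its two sides, the selector
term of Russo's formula is bounded below by pivotality probabilities of the eighteen interior
labels next to it (`Cone3.real_N_le_real_G_add`):

`P(Â^{σ←0} \ Â^{σ←1}) ≤ P(Â^{σ←1} \ Â^{σ←0}) + 1920000 · Σ_{g ∈ Π} P(g pivotal)`,

uniformly in `ρ ∈ [0, 1]` and `c ∈ [0, 1]`: parts 11 (conditioning on the four fair coins),
14 + 12–13 (`c ≥ 1/10`: no atom means domination, atoms are charged to walks) and 15–16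
(`c ≤ 1/10`: chains and absorption of the two-sided event).  Moreover every tuple `(b, d)` either
lies in the box with its interior vertices off the two sides (and then satisfies the eight
geometric hypotheses used above), or its sub-edges never matter for the crossing — no sub-edge
has both ends in the box, or the whole tuple lies in one side (`Cone3.good_or_irrelevant`, an
exercise on the divisibility of the box bounds by 3); so the inequality holds for every tuple
once `n ≥ 1` (`Cone3.real_N_le_real_G_add'`).

References: Aizenman–Grimmett 1991 §3; Grimmett 1999 §2.4.
-/

noncomputable section

namespace Summit.CriticalPhenomena.CardyFormulaZ2.Cruxes.CriticalPathRSW.FiniteSizeEnvelope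

open Set MeasureTheory
open Literature.Probability.LatticeModels Literature.Probability.Percolation

namespace Cone3

variable {n : ℕ} {ρ c : ℝ} {b : Site 2} {d d' : Fin 2}

set_option quotPrecheck false

/-- The local frame of the tuple `(b, d)`: `pt⟪α, β⟫ = 3b + α e_d + β e_{d'}`. -/
local notation "pt⟪" α ", " β "⟫" =>
  ((3 : ℤ) • b + (α : ℤ) • (Pi.single d (1 : ℤ) : Site 2) + (β : ℤ) • (Pi.single d' (1 : ℤ) : Site 2))

/-- The open labels of a coin configuration. -/
local notation "Op⟪" S "⟫" => {e : Site 2 × Fin 2 | RefinementOpen 3 S e}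

/-- Crossing of the box by a label configuration. -/
local notation "Cr⟪" V "⟫" => (edgeConfig V ∈ KST2023.crossing (3 * n) (3 * (3 * n)))

/-- The override event: close `C`, open `A`, and ask for a left-right crossing of the box. -/
local notation "Z⟪" C ", " A "⟫" =>
  {S : Set (Site 2 × Fin 2 × Fin 3) |
    edgeConfig ((Op⟪S⟫ \ C) ∪ A) ∈ KST2023.crossing (3 * n) (3 * (3 * n))}

/-- The three sub-edges of the tuple. -/
local notation "Tl" =>
  ({(pt⟪0, 0⟫, d), (pt⟪1, 0⟫, d), (pt⟪2, 0⟫, d)} : Set (Site 2 × Fin 2))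

/-- The box. -/
local notation "Bx" => (KST2023.box (3 * n) (3 * (3 * n)))

/-- Its left side. -/
local notation "Lx" => {x : Site 2 | x ∈ KST2023.box (3 * n) (3 * (3 * n)) ∧ x 0 = -((3 * n : ℕ) : ℤ)}

/-- Its right side. -/
local notation "Rx" => {x : Site 2 | x ∈ KST2023.box (3 * n) (3 * (3 * n)) ∧ x 0 = ((3 * n : ℕ) : ℤ)}

/-- The four interior labels at the interior vertices of the tuple. -/
local notation "Fl" =>
  ({(pt⟪1, 0⟫, d'), (pt⟪1, -1⟫, d'), (pt⟪2, 0⟫, d'), (pt⟪2, -1⟫, d')} : Set (Site 2 × Fin 2))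

/-- The same four labels, as a `Finset`. -/
local notation "Flf" =>
  ({(pt⟪1, 0⟫, d'), (pt⟪1, -1⟫, d'), (pt⟪2, 0⟫, d'), (pt⟪2, -1⟫, d')} : Finset (Site 2 × Fin 2))

/-- Their four own coins. -/
local notation "Fc" =>
  ({(pt⟪1, 0⟫, d', (0 : Fin 3)), (pt⟪1, -1⟫, d', (0 : Fin 3)), (pt⟪2, 0⟫, d', (0 : Fin 3)),
    (pt⟪2, -1⟫, d', (0 : Fin 3))} : Finset (Site 2 × Fin 2 × Fin 3))

/-- Pivotality of the own coin of the interior label `g`. -/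
local notation "Piv⟪" g "⟫" =>
  ({S : Set (Site 2 × Fin 2 × Fin 3) |
      edgeConfig ((Op⟪S⟫ \ {g}) ∪ {g}) ∈ KST2023.crossing (3 * n) (3 * (3 * n))} \
    {S : Set (Site 2 × Fin 2 × Fin 3) |
      edgeConfig ((Op⟪S⟫ \ {g}) ∪ ∅) ∈ KST2023.crossing (3 * n) (3 * (3 * n))})

/-- The chain event of `(S₁, f)`: `S₁ ∪ {f}` closed, tuple open, `f` pivotal. -/
local notation "Ech⟪" S₁ ", " f "⟫" => (Z⟪{f} ∪ ↑S₁, {f} ∪ Tl⟫ \ Z⟪{f} ∪ ↑S₁, ∅ ∪ Tl⟫)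

/-- The two-sided event: with `F` closed the whole tuple is pivotal. -/
local notation "C2" => (Z⟪Tl ∪ Fl, Tl⟫ \ Z⟪Tl ∪ Fl, (∅ : Set (Site 2 × Fin 2))⟫)

/-- The eighteen interior labels next to the tuple used by the walks. -/
local notation "Πf" =>
  ({(pt⟪0, 1⟫, d), (pt⟪1, 0⟫, d'), (pt⟪-1, 0⟫, d'), (pt⟪-1, 1⟫, d), (pt⟪2, 1⟫, d), (pt⟪2, 0⟫, d'),
    (pt⟪4, 0⟫, d'), (pt⟪3, 1⟫, d), (pt⟪1, 1⟫, d),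
    (pt⟪0, -1⟫, d), (pt⟪1, -1⟫, d'), (pt⟪-1, -1⟫, d'), (pt⟪-1, -1⟫, d), (pt⟪2, -1⟫, d), (pt⟪2, -1⟫, d'),
    (pt⟪4, -1⟫, d'), (pt⟪3, -1⟫, d), (pt⟪1, -1⟫, d)} : Finset (Site 2 × Fin 2))

/-- The coin law. -/
local notation "P" => (prodBernoulli (refinementParam 3 ρ c))


/-- The sub-edges whose own coin lies in `X`. -/
local notation "Tof⟪" X "⟫" =>
  {e : Site 2 × Fin 2 | (e = (pt⟪0, 0⟫, d) ∧ (pt⟪0, 0⟫, d, (0 : Fin 3)) ∈ X) ∨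
    (e = (pt⟪1, 0⟫, d) ∧ (pt⟪1, 0⟫, d, (0 : Fin 3)) ∈ X) ∨ (e = (pt⟪2, 0⟫, d) ∧ (pt⟪2, 0⟫, d, (0 : Fin 3)) ∈ X)}

/-- The three own coins, as a `Finset`. -/
local notation "F₃" =>
  ({(pt⟪0, 0⟫, d, (0 : Fin 3)), (pt⟪1, 0⟫, d, (0 : Fin 3)), (pt⟪2, 0⟫, d, (0 : Fin 3))} :
    Finset (Site 2 × Fin 2 × Fin 3))

/-- The cylinder "`F` closed". -/
local notation "CylF" => (localCylinder (↑Fc : Set (Site 2 × Fin 2 × Fin 3)) (∅ : Set (Site 2 × Fin 2 × Fin 3)))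

/-- The pulled-back crossing event. -/
local notation "Â" => ((refinementConfig 3) ⁻¹' KST2023.crossing (3 * n) (3 * (3 * n)))

/-- The shared coin and the three own coins, as a `Finset`. -/
local notation "F₄" =>
  ({(b, d, (1 : Fin 3)), (pt⟪0, 0⟫, d, (0 : Fin 3)), (pt⟪1, 0⟫, d, (0 : Fin 3)), (pt⟪2, 0⟫, d, (0 : Fin 3))} :
    Finset (Site 2 × Fin 2 × Fin 3))

/-- **The one-sided cone inequality of a tuple.** -/
theorem real_N_le_real_G_add (hd : d' ≠ d) (hρ0 : 0 ≤ ρ) (hρ1 : ρ ≤ 1) (hc0 : 0 ≤ c) (hc1 : c ≤ 1)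
    (hbox : ∀ j : ℤ, 0 ≤ j → j ≤ 3 → pt⟪j, 0⟫ ∈ Bx) (hrow : pt⟪0, 1⟫ ∈ Bx ∨ pt⟪0, -1⟫ ∈ Bx)
    (hm1 : pt⟪1, 0⟫ ∉ Lx ∧ pt⟪1, 0⟫ ∉ Rx) (hm2 : pt⟪2, 0⟫ ∉ Lx ∧ pt⟪2, 0⟫ ∉ Rx) (huR : pt⟪0, 0⟫ ∉ Rx)
    (huL : pt⟪0, 0⟫ ∈ Lx → ∀ s : ℤ, (s = 1 ∨ s = -1) → pt⟪0, s⟫ ∈ Bx → pt⟪0, s⟫ ∈ Lx)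
    (hwL : pt⟪3, 0⟫ ∉ Lx)
    (hwR : pt⟪3, 0⟫ ∈ Rx → ∀ s : ℤ, (s = 1 ∨ s = -1) → pt⟪3, s⟫ ∈ Bx → pt⟪3, s⟫ ∈ Rx) :
    (P).real ({S : Set (Site 2 × Fin 2 × Fin 3) | S \ {(b, d, (2 : Fin 3))} ∈ Â} \
        {S | insert (b, d, (2 : Fin 3)) S ∈ Â}) ≤
      (P).real ({S : Set (Site 2 × Fin 2 × Fin 3) | insert (b, d, (2 : Fin 3)) S ∈ Â} \
        {S | S \ {(b, d, (2 : Fin 3))} ∈ Â}) + 1920000 * ∑ g' ∈ Πf, (P).real Piv⟪g'⟫ := by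
  set PS := ∑ g' ∈ Πf, (P).real Piv⟪g'⟫ with hPS
  have hPS0 : 0 ≤ PS := Finset.sum_nonneg fun _ _ => measureReal_nonneg
  set NN := (P).real ({S : Set (Site 2 × Fin 2 × Fin 3) | S \ {(b, d, (2 : Fin 3))} ∈ Â} \
    {S | insert (b, d, (2 : Fin 3)) S ∈ Â}) with hNN
  set GG := (P).real ({S : Set (Site 2 × Fin 2 × Fin 3) | insert (b, d, (2 : Fin 3)) S ∈ Â} \
    {S | S \ {(b, d, (2 : Fin 3))} ∈ Â}) with hGG
  set q := (P).real (localCylinder (↑F₄ : Set (Site 2 × Fin 2 × Fin 3)) ∅) with hq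
  have hq0 : 0 ≤ q := measureReal_nonneg
  have hq1 : q ≤ 1 := measureReal_le_one
  set SL := ∑ pat ∈ (F₃).powerset, (P).real (Z⟪Tl, Tof⟪(↑pat : Set (Site 2 × Fin 2 × Fin 3))⟫⟫ \
    Z⟪Tl, (∅ : Set (Site 2 × Fin 2))⟫) with hSL
  set SR := ∑ pat ∈ (F₃).powerset, (P).real (Z⟪Tl, Tl⟫ \ Z⟪Tl, Tof⟪(↑pat : Set (Site 2 × Fin 2 × Fin 3))⟫⟫)
    with hSR
  have hSR0 : 0 ≤ SR := Finset.sum_nonneg fun _ _ => measureReal_nonneg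
  have hN : NN ≤ q * SL := real_N_le (n := n) (ρ := ρ) (c := c) hd
  have hG : q * SR ≤ GG := real_G_ge (n := n) (ρ := ρ) (c := c) hd
  have hLR : SL ≤ SR + 1920000 * PS := by
    by_cases hc : c ≤ 1 / 10
    · have h := sum_patterns_le_smallC (n := n) hd hρ0 hρ1 hc0 hc hbox hm1 hm2 huR
      linarith
    · push Not at hc
      have h1 := sum_patterns_le (n := n) (ρ := ρ) (c := c) (b := b) (d := d) (d' := d')
      have h2 := real_atom_le (n := n) hd hρ0 hρ1 hc.le hc1 hbox hrow huR huL hwL hwR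
      linarith
  have h1 : q * SL ≤ q * (SR + 1920000 * PS) := mul_le_mul_of_nonneg_left hLR hq0
  have h2 : q * (1920000 * PS) ≤ 1 * (1920000 * PS) := mul_le_mul_of_nonneg_right hq1 (mul_nonneg (by norm_num) hPS0)
  linarith

/-! ### Frame coordinates -/

/-- The coordinates of a frame point, `d = 0`. -/
theorem pt_apply_zero_one (hd : d' ≠ d) (h0 : d = 0) (α β : ℤ) :
    (pt⟪α, β⟫) 0 = 3 * b 0 + α ∧ (pt⟪α, β⟫) 1 = 3 * b 1 + β := by
  have h1 : d' = 1 := by rcases fin2_cases hd with ⟨-, h⟩ | ⟨h, -⟩ <;> [exact h; exact absurd h (h0 ▸ by decide)]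
  subst h0; subst h1
  exact ⟨pt_apply_d hd α β, pt_apply_d' hd α β⟩

/-- The coordinates of a frame point, `d = 1`. -/
theorem pt_apply_one_zero (hd : d' ≠ d) (h0 : d = 1) (α β : ℤ) :
    (pt⟪α, β⟫) 0 = 3 * b 0 + β ∧ (pt⟪α, β⟫) 1 = 3 * b 1 + α := by
  have h1 : d' = 0 := by rcases fin2_cases hd with ⟨h, -⟩ | ⟨-, h⟩ <;> [exact absurd h (h0 ▸ by decide); exact h]
  subst h0; subst h1
  exact ⟨pt_apply_d' hd α β, pt_apply_d hd α β⟩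

/-- Membership of a frame point in the box, `d = 0`. -/
theorem pt_mem_Bx_iff_zero (hd : d' ≠ d) (h0 : d = 0) (α β : ℤ) :
    pt⟪α, β⟫ ∈ Bx ↔ (-(3 * (n : ℤ)) ≤ 3 * b 0 + α ∧ 3 * b 0 + α ≤ 3 * n) ∧
      (-(9 * (n : ℤ)) ≤ 3 * b 1 + β ∧ 3 * b 1 + β ≤ 9 * n) := by
  obtain ⟨h1, h2⟩ := pt_apply_zero_one hd h0 α β
  rw [KST2023.mem_box, h1, h2, abs_le, abs_le]
  push_cast
  constructor <;> rintro ⟨⟨a1, a2⟩, ⟨a3, a4⟩⟩ <;> refine ⟨⟨by linarith, by linarith⟩, ⟨by linarith, by linarith⟩⟩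

/-- Membership of a frame point in the box, `d = 1`. -/
theorem pt_mem_Bx_iff_one (hd : d' ≠ d) (h0 : d = 1) (α β : ℤ) :
    pt⟪α, β⟫ ∈ Bx ↔ (-(3 * (n : ℤ)) ≤ 3 * b 0 + β ∧ 3 * b 0 + β ≤ 3 * n) ∧
      (-(9 * (n : ℤ)) ≤ 3 * b 1 + α ∧ 3 * b 1 + α ≤ 9 * n) := by
  obtain ⟨h1, h2⟩ := pt_apply_one_zero hd h0 α β
  rw [KST2023.mem_box, h1, h2, abs_le, abs_le]
  push_cast
  constructor <;> rintro ⟨⟨a1, a2⟩, ⟨a3, a4⟩⟩ <;> refine ⟨⟨by linarith, by linarith⟩, ⟨by linarith, by linarith⟩⟩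

/-- Membership in the left side. -/
theorem mem_Lx_iff (x : Site 2) : x ∈ Lx ↔ x ∈ Bx ∧ x 0 = -(3 * (n : ℤ)) := by
  simp only [Set.mem_setOf_eq]; push_cast; exact Iff.rfl

/-- Membership in the right side. -/
theorem mem_Rx_iff (x : Site 2) : x ∈ Rx ↔ x ∈ Bx ∧ x 0 = 3 * (n : ℤ) := by
  simp only [Set.mem_setOf_eq]; push_cast; exact Iff.rfl

/-! ### The labels of the tuple -/

/-- The ends of a sub-edge. -/
theorem ends_of_mem_Tl (hd : d' ≠ d) {ℓ : Site 2 × Fin 2} (hℓ : ℓ ∈ Tl) :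
    ∃ j : ℤ, (j = 0 ∨ j = 1 ∨ j = 2) ∧ ℓ.1 = pt⟪j, 0⟫ ∧ ℓ.1 + Pi.single ℓ.2 1 = pt⟪j + 1, 0⟫ := by
  simp only [Set.mem_insert_iff, Set.mem_singleton_iff] at hℓ
  rcases hℓ with rfl | rfl | rfl
  · exact ⟨0, Or.inl rfl, rfl, by rw [pt_add_single_d hd]⟩
  · exact ⟨1, Or.inr (Or.inl rfl), rfl, by rw [pt_add_single_d hd]⟩
  · exact ⟨2, Or.inr (Or.inr rfl), rfl, by rw [pt_add_single_d hd]⟩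

/-! ### The classification -/

/-- **Every tuple is good or irrelevant** (`n ≥ 1`). -/
theorem good_or_irrelevant (hd : d' ≠ d) (hn : 1 ≤ n) :
    ((∀ j : ℤ, 0 ≤ j → j ≤ 3 → pt⟪j, 0⟫ ∈ Bx) ∧ (pt⟪0, 1⟫ ∈ Bx ∨ pt⟪0, -1⟫ ∈ Bx) ∧
      (pt⟪1, 0⟫ ∉ Lx ∧ pt⟪1, 0⟫ ∉ Rx) ∧ (pt⟪2, 0⟫ ∉ Lx ∧ pt⟪2, 0⟫ ∉ Rx) ∧ pt⟪0, 0⟫ ∉ Rx ∧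
      (pt⟪0, 0⟫ ∈ Lx → ∀ s : ℤ, (s = 1 ∨ s = -1) → pt⟪0, s⟫ ∈ Bx → pt⟪0, s⟫ ∈ Lx) ∧ pt⟪3, 0⟫ ∉ Lx ∧
      (pt⟪3, 0⟫ ∈ Rx → ∀ s : ℤ, (s = 1 ∨ s = -1) → pt⟪3, s⟫ ∈ Bx → pt⟪3, s⟫ ∈ Rx)) ∨
    (∀ (U A : Set (Site 2 × Fin 2)), A ⊆ Tl → (Cr⟪(U \ Tl) ∪ A⟫ ↔ Cr⟪U \ Tl⟫)) := by
  have hn' : (1 : ℤ) ≤ n := by exact_mod_cast hn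
  rcases fin2_cases hd with ⟨h0, h1⟩ | ⟨h0, h1⟩
  · -- horizontal tuple
    have hB := fun α β => pt_mem_Bx_iff_zero (n := n) (b := b) hd h0 α β
    have hX : ∀ α β : ℤ, (pt⟪α, β⟫) 0 = 3 * b 0 + α := fun α β => (pt_apply_zero_one hd h0 α β).1
    by_cases hall : ∀ j : ℤ, 0 ≤ j → j ≤ 3 → pt⟪j, 0⟫ ∈ Bx
    · left
      have hu := (hB 0 0).1 (hall 0 le_rfl (by norm_num))
      have hw := (hB 3 0).1 (hall 3 (by norm_num) le_rfl)
      refine ⟨hall, ?_, ?_, ?_, ?_, ?_, ?_, ?_⟩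
      · by_cases hy : 3 * b 1 + 1 ≤ 9 * (n : ℤ)
        · left; rw [hB]; omega
        · right; rw [hB]; omega
      · rw [mem_Lx_iff, mem_Rx_iff, hX]; omega
      · rw [mem_Lx_iff, mem_Rx_iff, hX]; omega
      · rw [mem_Rx_iff, hX]; omega
      · intro huL s _ hsB
        rw [mem_Lx_iff, hX] at huL ⊢
        exact ⟨hsB, by omega⟩
      · rw [mem_Lx_iff, hX]; omega
      · intro hwR s _ hsB
        rw [mem_Rx_iff, hX] at hwR ⊢
        exact ⟨hsB, by omega⟩
    · right
      intro U A hA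
      refine cr_union_iff_of_not_mem_box (fun ℓ hℓ hends => hall ?_)
      obtain ⟨j, hj, h1', h2'⟩ := ends_of_mem_Tl hd (hA hℓ)
      rw [h2', h1', hB, hB] at hends
      intro j' hj0 hj3
      rw [hB]
      omega
  · -- vertical tuple
    have hB := fun α β => pt_mem_Bx_iff_one (n := n) (b := b) hd h0 α β
    have hX : ∀ α β : ℤ, (pt⟪α, β⟫) 0 = 3 * b 0 + β := fun α β => (pt_apply_one_zero hd h0 α β).1
    by_cases hall : ∀ j : ℤ, 0 ≤ j → j ≤ 3 → pt⟪j, 0⟫ ∈ Bx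
    · have hu := (hB 0 0).1 (hall 0 le_rfl (by norm_num))
      by_cases hL : 3 * b 0 = -(3 * (n : ℤ))
      · right
        intro U A hA
        refine cr_union_iff_of_left (fun ℓ hℓ => ?_)
        obtain ⟨j, hj, h1', h2'⟩ := ends_of_mem_Tl hd (hA hℓ)
        rw [h2', h1', mem_Lx_iff, mem_Lx_iff, hX, hX]
        refine ⟨⟨hall j (by omega) (by omega), by omega⟩, ⟨hall (j + 1) (by omega) (by omega), by omega⟩⟩
      by_cases hR : 3 * b 0 = 3 * (n : ℤ)
      · right
        intro U A hA
        refine cr_union_iff_of_right (fun ℓ hℓ => ?_)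
        obtain ⟨j, hj, h1', h2'⟩ := ends_of_mem_Tl hd (hA hℓ)
        rw [h2', h1', mem_Rx_iff, mem_Rx_iff, hX, hX]
        refine ⟨⟨hall j (by omega) (by omega), by omega⟩, ⟨hall (j + 1) (by omega) (by omega), by omega⟩⟩
      left
      refine ⟨hall, ?_, ?_, ?_, ?_, ?_, ?_, ?_⟩
      · left; rw [hB]; omega
      · rw [mem_Lx_iff, mem_Rx_iff, hX]; omega
      · rw [mem_Lx_iff, mem_Rx_iff, hX]; omega
      · rw [mem_Rx_iff, hX]; omega
      · intro huL; rw [mem_Lx_iff, hX] at huL; omega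
      · rw [mem_Lx_iff, hX]; omega
      · intro hwR; rw [mem_Rx_iff, hX] at hwR; omega
    · right
      intro U A hA
      refine cr_union_iff_of_not_mem_box (fun ℓ hℓ hends => hall ?_)
      obtain ⟨j, hj, h1', h2'⟩ := ends_of_mem_Tl hd (hA hℓ)
      rw [h2', h1', hB, hB] at hends
      intro j' hj0 hj3
      rw [hB]
      omega

/-- **The one-sided cone inequality of every tuple** (`n ≥ 1`). -/
theorem real_N_le_real_G_add' (hd : d' ≠ d) (hn : 1 ≤ n) (hρ0 : 0 ≤ ρ) (hρ1 : ρ ≤ 1) (hc0 : 0 ≤ c) (hc1 : c ≤ 1) :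
    (P).real ({S : Set (Site 2 × Fin 2 × Fin 3) | S \ {(b, d, (2 : Fin 3))} ∈ Â} \
        {S | insert (b, d, (2 : Fin 3)) S ∈ Â}) ≤
      (P).real ({S : Set (Site 2 × Fin 2 × Fin 3) | insert (b, d, (2 : Fin 3)) S ∈ Â} \
        {S | S \ {(b, d, (2 : Fin 3))} ∈ Â}) + 1920000 * ∑ g' ∈ Πf, (P).real Piv⟪g'⟫ := by
  rcases good_or_irrelevant (n := n) hd hn with ⟨hbox, hrow, hm1, hm2, huR, huL, hwL, hwR⟩ | hirr
  · exact real_N_le_real_G_add hd hρ0 hρ1 hc0 hc1 hbox hrow hm1 hm2 huR huL hwL hwR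
  · have heq := sections_eq_of_irrelevant (n := n) hd hirr
    have hPS0 : 0 ≤ ∑ g' ∈ Πf, (P).real Piv⟪g'⟫ := Finset.sum_nonneg fun _ _ => measureReal_nonneg
    rw [heq, Set.sdiff_self, measureReal_empty]
    nlinarith [hPS0]

end Cone3

/-- **Registered sub-goal `stub_cone3_tuple` of stub `stub_cone3`** (`Cone3.good_or_irrelevant` with all local notations
expanded). -/
theorem stub_cone3_tuple : ∀ {n : ℕ} {b : Site 2} {d d' : Fin 2} (hd : d' ≠ d) (hn : 1 ≤ n), ((∀ j : ℤ, 0 ≤ j → j ≤ 3 → ((3 : ℤ) • b + (j : ℤ) • (Pi.single d (1 : ℤ) : Site 2) + (0 : ℤ) • (Pi.single d' (1 : ℤ) : Site 2)) ∈ (KST2023.box (3 * n) (3 * (3 * n)))) ∧ (((3 : ℤ) • b + (0 : ℤ) • (Pi.single d (1 : ℤ) : Site 2) + (1 : ℤ) • (Pi.single d' (1 : ℤ) : Site 2)) ∈ (KST2023.box (3 * n) (3 * (3 * n))) ∨ ((3 : ℤ) • b + (0 : ℤ) • (Pi.single d (1 : ℤ) : Site 2) + (-1 : ℤ) • (Pi.single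 d' (1 : ℤ) : Site 2)) ∈ (KST2023.box (3 * n) (3 * (3 * n)))) ∧ (((3 : ℤ) • b + (1 : ℤ) • (Pi.single d (1 : ℤ) : Site 2) + (0 : ℤ) • (Pi.single d' (1 : ℤ) : Site 2)) ∉ {x : Site 2 | x ∈ KST2023.box (3 * n) (3 * (3 * n)) ∧ x 0 = -((3 * n : ℕ) : ℤ)} ∧ ((3 : ℤ) • b + (1 : ℤ) • (Pi.single d (1 : ℤ) : Site 2) + (0 : ℤ) • (Pi.single d' (1 : ℤ) : Site 2)) ∉ {x : Site 2 | x ∈ KST2023.box (3 * n) (3 * (3 * n)) ∧ x 0 = ((3 * n : ℕ) : ℤ)}) ∧ (((3 : ℤ) • b + (2 : ℤ) • (Pi.single d (1 : ℤ) : Site 2) + (0 : ℤ) • (Pi.single d' (1 : ℤ) : Site 2)) ∉ {x : Site 2 | x ∈ KST2023.box (3 * n) (3 * (3 * n)) ∧ x 0 = -((3 * n : ℕ) : ℤ)} ∧ ((3 : ℤ) • b + (2 : ℤ) • (Pi.single d (1 : ℤ) : Site 2) + (0 : ℤ) • (Pi.single d' (1 : ℤ) : Site 2)) ∉ {x : Site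 2 | x ∈ KST2023.box (3 * n) (3 * (3 * n)) ∧ x 0 = ((3 * n : ℕ) : ℤ)}) ∧ ((3 : ℤ) • b + (0 : ℤ) • (Pi.single d (1 : ℤ) : Site 2) + (0 : ℤ) • (Pi.single d' (1 : ℤ) : Site 2)) ∉ {x : Site 2 | x ∈ KST2023.box (3 * n) (3 * (3 * n)) ∧ x 0 = ((3 * n : ℕ) : ℤ)} ∧ (((3 : ℤ) • b + (0 : ℤ) • (Pi.single d (1 : ℤ) : Site 2) + (0 : ℤ) • (Pi.single d' (1 : ℤ) : Site 2)) ∈ {x : Site 2 | x ∈ KST2023.box (3 * n) (3 * (3 * n)) ∧ x 0 = -((3 * n : ℕ) : ℤ)} → ∀ s : ℤ, (s = 1 ∨ s = -1) → ((3 : ℤ) • b + (0 : ℤ) • (Pi.single d (1 : ℤ) : Site 2) + (s : ℤ) • (Pi.single d' (1 : ℤ) : Site 2)) ∈ (KST2023.box (3 * n) (3 * (3 * n))) → ((3 : ℤ) • b + (0 : ℤ) • (Pi.single d (1 : ℤ) : Site 2) + (s : ℤ) • (Pi.single d' (1 : ℤ) : Site 2)) ∈ {x : Site 2 | x ∈ KST2023.box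 (3 * n) (3 * (3 * n)) ∧ x 0 = -((3 * n : ℕ) : ℤ)}) ∧ ((3 : ℤ) • b + (3 : ℤ) • (Pi.single d (1 : ℤ) : Site 2) + (0 : ℤ) • (Pi.single d' (1 : ℤ) : Site 2)) ∉ {x : Site 2 | x ∈ KST2023.box (3 * n) (3 * (3 * n)) ∧ x 0 = -((3 * n : ℕ) : ℤ)} ∧ (((3 : ℤ) • b + (3 : ℤ) • (Pi.single d (1 : ℤ) : Site 2) + (0 : ℤ) • (Pi.single d' (1 : ℤ) : Site 2)) ∈ {x : Site 2 | x ∈ KST2023.box (3 * n) (3 * (3 * n)) ∧ x 0 = ((3 * n : ℕ) : ℤ)} → ∀ s : ℤ, (s = 1 ∨ s = -1) → ((3 : ℤ) • b + (3 : ℤ) • (Pi.single d (1 : ℤ) : Site 2) + (s : ℤ) • (Pi.single d' (1 : ℤ) : Site 2)) ∈ (KST2023.box (3 * n) (3 * (3 * n))) → ((3 : ℤ) • b + (3 : ℤ) • (Pi.single d (1 : ℤ) : Site 2) + (s : ℤ) • (Pi.single d' (1 : ℤ) : Site 2)) ∈ {x : Site 2 | x ∈ KST2023.box (3 * n) (3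 * (3 * n)) ∧ x 0 = ((3 * n : ℕ) : ℤ)})) ∨ (∀ (U A : Set (Site 2 × Fin 2)), A ⊆ ({(((3 : ℤ) • b + (0 : ℤ) • (Pi.single d (1 : ℤ) : Site 2) + (0 : ℤ) • (Pi.single d' (1 : ℤ) : Site 2)), d), (((3 : ℤ) • b + (1 : ℤ) • (Pi.single d (1 : ℤ) : Site 2) + (0 : ℤ) • (Pi.single d' (1 : ℤ) : Site 2)), d), (((3 : ℤ) • b + (2 : ℤ) • (Pi.single d (1 : ℤ) : Site 2) + (0 : ℤ) • (Pi.single d' (1 : ℤ) : Site 2)), d)} : Set (Site 2 × Fin 2)) → ((edgeConfig ((U \ ({(((3 : ℤ) • b + (0 : ℤ) • (Pi.single d (1 : ℤ) : Site 2) + (0 : ℤ) • (Pi.single d' (1 : ℤ) : Site 2)), d), (((3 : ℤ) • b + (1 : ℤ) • (Pi.single d (1 : ℤ) : Site 2) + (0 : ℤ) • (Pi.single d' (1 : ℤ) : Site 2)), d), (((3 : ℤ) • b + (2 : ℤ) • (Pi.single d (1 : ℤ) : Site 2) + (0 : ℤ) • (Pi.single d' (1 : ℤ) : Site 2)), d)}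 : Set (Site 2 × Fin 2))) ∪ A) ∈ KST2023.crossing (3 * n) (3 * (3 * n))) ↔ (edgeConfig (U \ ({(((3 : ℤ) • b + (0 : ℤ) • (Pi.single d (1 : ℤ) : Site 2) + (0 : ℤ) • (Pi.single d' (1 : ℤ) : Site 2)), d), (((3 : ℤ) • b + (1 : ℤ) • (Pi.single d (1 : ℤ) : Site 2) + (0 : ℤ) • (Pi.single d' (1 : ℤ) : Site 2)), d), (((3 : ℤ) • b + (2 : ℤ) • (Pi.single d (1 : ℤ) : Site 2) + (0 : ℤ) • (Pi.single d' (1 : ℤ) : Site 2)), d)} : Set (Site 2 × Fin 2))) ∈ KST2023.crossing (3 * n) (3 * (3 * n))))) := by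
  intro n b d d' hd hn
  exact Cone3.good_or_irrelevant hd hn

end Summit.CriticalPhenomena.CardyFormulaZ2.Cruxes.CriticalPathRSW.FiniteSizeEnvelope

end
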